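import Literature.NumberTheory.DiophantineGeometry.LocalReduction
import HarnessLib

/-!
# Reduction types of a Weierstrass curve at a finite place — the minimality criterion `ord_v (Δ) < 12`

Discharge of the named fact `WeierstrassCurve.isMinimalAt_of_lt_valuation_Δ` stated in
`Literature.NumberTheory.DiophantineGeometry.LocalReduction` (kept in a sibling file so that the
statement file stays a definitions/named-facts file, and separate from `LocalReductionProofs` so as
not to interfere with the discharges of the neighbouring facts).

Silverman, AEC 2nd ed., §VII.1, Remark 1.1 (PDF p. 165 of the held copy): "`aᵢ ∈ R` and `v(Δ) < 12`
⟹ the equation is minimal". Printed proof: a coordinate change (III.1.2) gives a new equation with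
`Δ' = u⁻¹² Δ`, so `v(Δ)` can only change by multiples of `12`; if the new equation is integral then
`0 ≤ v(Δ') = v(Δ) - 12 v(u)`, and `v(Δ) < 12` forces `v(u) ≤ 0`, i.e. `v(Δ') ≥ v(Δ)`.

In Lean: `W.IsMinimalAt v` is Mathlib's `IsMinimal O_v (W.baseChange K_v)`, which unfolds
(`WeierstrassCurve.isMinimal_iff_of_le_one_iff` with the valuation `Valued.v` of `K_v`, whose
valuation ring is `O_v`) to "integral, and every `O_v`-integral `C • X` has `|Δ(C • X)|ᵥ ≤ |Δ(X)|ᵥ`".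
Here `|Δ(C • X)|ᵥ = |u⁻¹|ᵥ¹² |Δ(X)|ᵥ` (`WeierstrassCurve.variableChange_Δ`), `|Δ(C • X)|ᵥ ≤ 1` by
integrality, `|Δ(X)|ᵥ = v (Δ) > exp (-12)` by hypothesis, and after `WithZero.log : ℤᵐ⁰ → ℤ` the
claim is the displayed integer inequality (`omega`).

## References

* J. H. Silverman, *The Arithmetic of Elliptic Curves*, GTM 106, 2nd ed. 2009, §VII.1, Remark 1.1
  (PDF p. 165).
-/

open IsDedekindDomain

namespace WeierstrassCurve

section MinimalityCriterion

variable {A : Type*} [CommRing A] [IsDedekindDomain A] {K : Type*} [Field K]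
  [Algebra A K] [IsFractionRing A K] {v : HeightOneSpectrum A} {W : WeierstrassCurve K}

/-- Discharge of `WeierstrassCurve.isMinimalAt_of_lt_valuation_Δ`: a `v`-integral Weierstrass
equation with `ord_v (Δ) < 12` (i.e. `exp (-12) < v (Δ)` in `ℤᵐ⁰`) is minimal at `v`. If `C • X`
(`X = W.baseChange K_v`) is `O_v`-integral then `|Δ(C • X)|ᵥ = |u⁻¹|ᵥ¹² |Δ|ᵥ ≤ 1`; together with
`exp (-12) < |Δ|ᵥ` this forces `|u⁻¹|ᵥ ≤ 1`, hence `|Δ(C • X)|ᵥ ≤ |Δ|ᵥ`.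
[cite: SilvermanAEC2009, VII.1 Remark 1.1] -/
theorem isMinimalAt_of_lt_valuation_Δ_holds : isMinimalAt_of_lt_valuation_Δ (v := v) (W := W) := by
  intro hW h
  rw [IsMinimalAt,
    isMinimal_iff_of_le_one_iff (valued_le_one_iff_mem_range_adicCompletionIntegers v)]
  refine ⟨hW, fun C hC ↦ ?_⟩
  -- the discriminant of the integral equation `C • X` is integral
  have hint : Valued.v (C • W.baseChange (v.adicCompletion K)).Δ ≤ 1 := by
    obtain ⟨r, hr⟩ := Δ_integral_of_isIntegral (v.adicCompletionIntegers K)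
      (C • W.baseChange (v.adicCompletion K))
    rw [← hr]
    exact (valued_le_one_iff_mem_range_adicCompletionIntegers v _).mpr ⟨r, rfl⟩
  -- `|Δ|ᵥ` is read off in `K`: move the hypothesis `h` to `K_v`
  have hΔ : Valued.v (W.baseChange (v.adicCompletion K)).Δ = v.valuation K W.Δ := by
    simp only [baseChange, map_Δ, valued_algebraMap_adicCompletion]
  rw [← hΔ] at h
  rw [variableChange_Δ, Valuation.map_mul, Valuation.map_pow] at hint ⊢
  set a := Valued.v (↑C.u⁻¹ : v.adicCompletion K) with ha
  set d := Valued.v (W.baseChange (v.adicCompletion K)).Δ with hd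
  have ha0 : a ≠ 0 := by simp [ha]
  have hd0 : d ≠ 0 := (WithZero.exp_pos.trans h).ne'
  have had0 : a ^ 12 * d ≠ 0 := mul_ne_zero (pow_ne_zero _ ha0) hd0
  -- pass to `ℤ` through `WithZero.log`
  have h1 : -12 < WithZero.log d := WithZero.lt_log_of_exp_lt h
  have h2 : 12 • WithZero.log a + WithZero.log d ≤ 0 := by
    rw [← WithZero.log_pow, ← WithZero.log_mul (pow_ne_zero _ ha0) hd0, ← WithZero.log_one]
    exact (WithZero.log_le_log had0 one_ne_zero).mpr hint
  refine (WithZero.log_le_log had0 hd0).mp ?_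
  rw [WithZero.log_mul (pow_ne_zero _ ha0) hd0, WithZero.log_pow]
  simp only [nsmul_eq_mul, Nat.cast_ofNat] at h2 ⊢
  omega

end MinimalityCriterion

end WeierstrassCurve
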